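import Literature.GroupTheory.CombinatorialGroupTheory.QuadraticSystems
import Literature.GroupTheory.CombinatorialGroupTheory.QuadraticWordsOneVertexSurfaceGroups
import Literature.GroupTheory.CombinatorialGroupTheory.QuadraticWordsVerticesBridge
import Literature.GroupTheory.CombinatorialGroupTheory.PuncturedSurfaceGroupFree
import Literature.GroupTheory.CombinatorialGroupTheory.FreeGroupHopfian
import HarnessLib

/-!
# Boundary normal form of a one-vertex ribbon graph, I: tools and the one-face case

Topic `Literature/GroupTheory/CombinatorialGroupTheory`; continues `QuadraticSystems.lean` and
`QuadraticWordsOneVertexSurfaceGroups.lean`.  A SYSTEM of faces `Fs` (ZVC §3.1) over the letters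
`ι × Bool` all of whose letters are distinct and which contains, with every letter, its partner, and
whose vertex permutation `sysPerm Fs` is transitive, is — read dually — a connected orientable
ribbon graph with ONE vertex whose boundary cycles are the faces.  Its fundamental group is the free
group on the symbols `S ⊆ ι` used, and the classical classification of compact orientable surfaces
WITH BOUNDARY says that the boundary words form the peripheral system of a punctured-surface-group
structure: there is an isomorphism `Γ_{g,F} = ⟨aᵢ, bᵢ, c_k ∣ ∏[aᵢ,bᵢ] c₁⋯c_F⟩ ≅ F(S)` carrying each
`c_k` to a conjugate of (the inverse of) one boundary word, bijectively (`2g + F = |S| + 1`).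

This file proves the case of ONE face (`exists_hom_of_one_face`): it is exactly the closed-surface
normal form of Zieschang–Vogt–Coldewey Thm. 3.2.6 / 3.1.8 as formalised by
`OneVertex.exists_mulEquiv_map_surfaceRelator` (a one-vertex alternating quadratic word is a
relabelled `∏[aᵢ,bᵢ]`), transported to a sub-alphabet `S ⊆ ι` and repackaged as a homomorphism
from `Γ_{h,1}` (`c₁ ↦ (∏[aᵢ,bᵢ])⁻¹`).  Tools: `formPerm_map_apply` (cyclic successor under an
injective relabelling), `injective_of_range_eq_range_map` (the hopfian property of finitely
generated free groups, `FreeGroupHopfian.lean`, in the form "a homomorphism from a free group of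
rank `|S|` ONTO `F(S) ≤ F(ι)` is injective").  The induction on the number of faces (gluing,
ZVC 3.1.5) is in `RibbonBoundaryNormalForm.lean`.  Theorems only.

## References

* H. Zieschang, E. Vogt, H.-D. Coldewey, *Surfaces and Planar Discontinuous Groups*, LNM 835,
  Springer 1980, 3.1.5–3.1.8, Thm. 3.2.6, §4.14. [ZieschangVogtColdewey1980]
* R. C. Lyndon, P. E. Schupp, *Combinatorial Group Theory*, Ch. I Prop. 3.5. [LyndonSchupp2001]
-/

namespace Literature.GroupTheory.CombinatorialGroupTheory

open List Equiv Equiv.Perm Function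

universe u

variable {ι : Type u} [DecidableEq ι]

/-! ### Cyclic successor under an injective relabelling -/

/-- The cyclic successor permutation commutes with an injective relabelling of a duplicate-free
list: `formPerm (l.map f) (f x) = f (formPerm l x)` (relabelling a face does not change its
cyclic structure, ZVC 3.1.2). [cite: ZieschangVogtColdewey1980, 3.1.2] -/
theorem formPerm_map_apply {α β : Type*} [DecidableEq α] [DecidableEq β] {f : α → β}
    (hf : Injective f) {l : List α} (hl : l.Nodup) (x : α) :
    (l.map f).formPerm (f x) = f (l.formPerm x) := by
  by_cases hx : x ∈ l
  · obtain ⟨i, hi, rfl⟩ := getElem_of_mem hx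
    have hi' : i < (l.map f).length := by rw [length_map]; exact hi
    have e1 : f l[i] = (l.map f)[i] := (getElem_map f).symm
    rw [e1, formPerm_apply_getElem _ (hl.map hf) i hi', formPerm_apply_getElem _ hl i hi, getElem_map]
    simp only [length_map]
  · rw [formPerm_apply_of_notMem hx, formPerm_apply_of_notMem]
    exact fun h => hx ((mem_map_of_injective hf).1 h)

/-- Powers version of `formPerm_map_apply` for the vertex permutation: if `F` commutes with `bar`,
`(vertexPerm (w.map F))^n (F x) = F ((vertexPerm w)^n x)`. [cite: ZieschangVogtColdewey1980, 3.1.2] -/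
theorem vertexPerm_map_pow_apply {κ : Type*} [DecidableEq κ] {F : κ × Bool → ι × Bool}
    (hF : Injective F) (hbar : ∀ x, F (bar x) = bar (F x)) {w : List (κ × Bool)} (hw : w.Nodup)
    (n : ℕ) (x : κ × Bool) : (vertexPerm (w.map F) ^ n) (F x) = F ((vertexPerm w ^ n) x) := by
  induction n generalizing x with
  | zero => rfl
  | succ n ih =>
    have key : vertexPerm (w.map F) (F x) = F (vertexPerm w x) := by
      rw [vertexPerm_apply, vertexPerm_apply, ← hbar, formPerm_map_apply hF hw]
    simp only [pow_succ, Perm.mul_apply, key, ih]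

/-! ### Words over a sub-alphabet -/

omit [DecidableEq ι] in
/-- A word all of whose symbols lie in `S` is a word over the alphabet `↥S`, relabelled (ZVC 3.1.1:
words over a sub-alphabet). [cite: ZieschangVogtColdewey1980, 3.1.1] -/
theorem exists_map_eq_of_forall_fst_mem (S : Finset ι) (w : List (ι × Bool))
    (hw : ∀ x ∈ w, x.1 ∈ S) :
    ∃ w' : List (↥S × Bool), w'.map (fun x => ((x.1 : ι), x.2)) = w := by
  refine ⟨w.attach.map fun x => (⟨x.1.1, hw x.1 x.2⟩, x.1.2), ?_⟩
  rw [map_map]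
  conv_rhs => rw [← attach_map_subtype_val w]
  rfl

omit [DecidableEq ι] in
/-- The free group element of a word with symbols in `S` lies in the subgroup generated by `S`
(Lyndon–Schupp I.1: the subgroup generated by a subset of a basis). [cite: LyndonSchupp2001, Ch. I Prop. 1.1] -/
theorem mk_mem_closure_of_forall_fst_mem (S : Finset ι) :
    ∀ (w : List (ι × Bool)), (∀ x ∈ w, x.1 ∈ S) →
      FreeGroup.mk w ∈ Subgroup.closure ((fun i => FreeGroup.of i) '' (S : Set ι))
  | [], _ => by rw [show FreeGroup.mk ([] : List (ι × Bool)) = 1 from rfl]; exact one_mem _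
  | x :: w, h => by
    rw [← singleton_append, ← FreeGroup.mul_mk]
    refine mul_mem ?_ (mk_mem_closure_of_forall_fst_mem S w fun z hz => h z (mem_cons_of_mem _ hz))
    have hx : FreeGroup.of x.1 ∈ Subgroup.closure ((fun i => FreeGroup.of i) '' (S : Set ι)) :=
      Subgroup.subset_closure ⟨x.1, h x (by simp), rfl⟩
    obtain ⟨i, _ | _⟩ := x
    · have : FreeGroup.mk [(i, false)] = (FreeGroup.of i)⁻¹ := rfl
      rw [this]; exact inv_mem hx
    · exact hx

omit [DecidableEq ι] in
/-- The subgroup generated by the symbols of `S` is the range of the relabelling map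
`F(↥S) → F(ι)` — it is free on `S` (Lyndon–Schupp I Prop. 1.1: a subset of a basis freely generates
the subgroup it generates). [cite: LyndonSchupp2001, Ch. I Prop. 1.1] -/
theorem closure_eq_range_map (S : Finset ι) :
    Subgroup.closure ((fun i => FreeGroup.of i) '' (S : Set ι)) =
      (FreeGroup.map (Subtype.val : ↥S → ι)).range := by
  rw [FreeGroup.range_map, Subtype.range_val]

omit [DecidableEq ι] in
/-- **Hopfian injectivity criterion**: a homomorphism `θ` from a group isomorphic to a free group
`F(α)` into `F(ι)` whose range is exactly the subgroup generated by a finite set `S` of symbols with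
`|S| = |α|` is injective (a surjection between free groups of the same finite rank is an
isomorphism, Lyndon–Schupp I Prop. 3.5). [cite: LyndonSchupp2001, Ch. I Prop. 3.5] -/
theorem injective_of_range_eq_closure {G : Type*} [Group G] {α : Type*} [Finite α]
    (e : G ≃* FreeGroup α) (S : Finset ι) (hcard : Nat.card α = S.card) (θ : G →* FreeGroup ι)
    (hrange : θ.range = Subgroup.closure ((fun i => FreeGroup.of i) '' (S : Set ι))) :
    Injective θ := by
  classical
  rw [closure_eq_range_map] at hrange
  set ψ : FreeGroup ↥S →* FreeGroup ι := FreeGroup.map (Subtype.val : ↥S → ι) with hψ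
  have hψi : Injective ψ := FreeGroup.map_injective Subtype.val_injective
  -- factor `θ` through `ψ`
  let Ψ : FreeGroup ↥S ≃* ψ.range := MonoidHom.ofInjective hψi
  have hmem : ∀ x, θ x ∈ ψ.range := fun x => by rw [← hrange]; exact ⟨x, rfl⟩
  let φ : G →* FreeGroup ↥S := Ψ.symm.toMonoidHom.comp (θ.codRestrict ψ.range hmem)
  have hφ : ∀ x, ψ (φ x) = θ x := fun x => by
    change ψ (Ψ.symm ⟨θ x, hmem x⟩) = θ x
    rw [MonoidHom.apply_ofInjective_symm]
  have hsurj : Surjective φ := by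
    intro b
    obtain ⟨x, hx⟩ : ψ b ∈ θ.range := by rw [hrange]; exact ⟨b, rfl⟩
    exact ⟨x, hψi (by rw [hφ, hx])⟩
  have hcard' : Nat.card α = Nat.card ↥S := by rw [hcard, Nat.card_eq_fintype_card, Fintype.card_coe]
  have hinj := FreeGroup.injective_of_surjective_of_mulEquiv e hcard' φ hsurj
  intro x y hxy
  exact hinj (hψi (by rw [hφ, hφ, hxy]))

/-! ### The one-face case -/

/-- The commutator product `∏[aᵢ,bᵢ]` of `Γ_{g,r}`'s relator maps, under the assignment of the
`a`/`b`-generators, to the image of the closed surface relator `∏[aᵢ,bᵢ]` of `S_g` (the relator of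
ZVC 3.1.8 / 4.14 read in both presentations). [cite: ZieschangVogtColdewey1980, 3.1.8] -/
theorem lift_comm_eq {G : Type*} [Group G] (g r : ℕ) (f : puncturedSurfaceGen g r → G)
    (Φ : FreeGroup (Literature.Topology.FourManifolds.surfaceGen g) →* G)
    (hf : ∀ x : Fin g × Bool, f (Sum.inl x) = Φ (FreeGroup.of x)) :
    FreeGroup.lift f (((List.finRange g).map fun i =>
        PuncturedSurfaceGroup.genA (r := r) i * PuncturedSurfaceGroup.genB (r := r) i *
          (PuncturedSurfaceGroup.genA (r := r) i)⁻¹ * (PuncturedSurfaceGroup.genB (r := r) i)⁻¹).prod) =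
      Φ (Literature.Topology.FourManifolds.surfaceRelator g) := by
  simp only [Literature.Topology.FourManifolds.surfaceRelator, Literature.Topology.FourManifolds.genA,
    Literature.Topology.FourManifolds.genB, PuncturedSurfaceGroup.genA, PuncturedSurfaceGroup.genB,
    map_list_prod, List.map_map, Function.comp_def, map_mul, map_inv, FreeGroup.lift_apply_of, hf]

/-- **Boundary normal form, one face** (ZVC Thm. 3.2.6 / 3.1.8 over a sub-alphabet): let `w` be a
duplicate-free word whose letters are exactly the letters with symbol in `S ⊆ ι` and whose vertex
permutation is transitive (a one-vertex ribbon graph with a single boundary cycle `w`).  Then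
`|S| = 2h` and there is an INJECTIVE homomorphism `θ : Γ_{h,1} → F(ι)` with range the subgroup
generated by `S`, carrying the cusp generator `c₁` to a conjugate of `(mk w)⁻¹` by an element of the
range. [cite: ZieschangVogtColdewey1980, Thm 3.2.6 / 3.1.8] -/
theorem exists_hom_of_one_face [Fintype ι] (S : Finset ι) (w : List (ι × Bool)) (hd : w.Nodup)
    (hS : ∀ x : ι × Bool, x ∈ w ↔ x.1 ∈ S)
    (hV : ∀ x ∈ w, ∀ z ∈ w, (vertexPerm w).SameCycle x z) :
    ∃ h : ℕ, 2 * h + 1 = S.card + 1 ∧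
      ∃ θ : PuncturedSurfaceGroup h 1 →* FreeGroup ι, Injective θ ∧
        θ.range = Subgroup.closure ((fun i => FreeGroup.of i) '' (S : Set ι)) ∧
        ∃ u ∈ θ.range, θ (PuncturedSurfaceGroup.c 0) = u * (FreeGroup.mk w)⁻¹ * u⁻¹ := by
  classical
  -- relabel `w` over the alphabet `↥S`
  let F : ↥S × Bool → ι × Bool := fun x => ((x.1 : ι), x.2)
  have hF : Injective F := fun x y hxy => by
    simp only [F, Prod.mk.injEq] at hxy
    exact Prod.ext (Subtype.ext hxy.1) hxy.2
  have hFbar : ∀ x, F (bar x) = bar (F x) := fun _ => rfl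
  obtain ⟨w', hw'⟩ := exists_map_eq_of_forall_fst_mem S w fun x hx => (hS x).1 hx
  have hd' : w'.Nodup := Nodup.of_map F (by rw [hw']; exact hd)
  have hmem' : ∀ x : ↥S × Bool, x ∈ w' := fun x => by
    have hx : F x ∈ w := (hS (F x)).2 x.1.2
    rw [← hw'] at hx
    exact (mem_map_of_injective hF).1 hx
  have hq' : IsQuadratic w' := IsQuadratic.of_nodup hd' fun x _ => hmem' _
  have hall' : ∀ i : ↥S, (i, true) ∈ w' := fun i => hmem' _
  -- one vertex
  have hV' : OneVertex w' := by
    refine oneVertex_of_sameCycle hd' (fun x _ => hmem' _) (vertexPerm w') (fun x _ => rfl) ?_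
    intro x _ z _
    obtain ⟨n, hn⟩ := (hV (F x) ((hS _).2 x.1.2) (F z) ((hS _).2 z.1.2)).exists_nat_pow_eq
    rw [← hw', vertexPerm_map_pow_apply hF hFbar hd' n x] at hn
    exact ⟨n, by rw [zpow_natCast]; exact hF hn⟩
  -- the closed-surface normal form
  obtain ⟨h, hcard, Λ, c, hΛ⟩ := OneVertex.exists_mulEquiv_map_surfaceRelator hV' hq' hall'
  have hcardS : 2 * h = S.card := by rw [← hcard, Fintype.card_coe]
  refine ⟨h, by rw [hcardS], ?_⟩
  -- `θ' : Γ_{h,1} → F(↥S)`: `a, b ↦ Λ a, Λ b`, `c₁ ↦ Λ(∏[a,b])⁻¹`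
  let sr := Literature.Topology.FourManifolds.surfaceRelator h
  let f' : puncturedSurfaceGen h 1 → FreeGroup ↥S := fun x =>
    match x with
    | Sum.inl z => Λ (FreeGroup.of z)
    | Sum.inr _ => (Λ sr)⁻¹
  have hrel : ∀ v ∈ ({PuncturedSurfaceGroup.relator h 1} : Set (FreeGroup (puncturedSurfaceGen h 1))),
      FreeGroup.lift f' v = 1 := by
    intro v hv
    rw [Set.mem_singleton_iff] at hv
    rw [hv, PuncturedSurfaceGroup.relator_succ, map_mul, map_mul,
      lift_comm_eq h 1 f' Λ.toMonoidHom (fun x => rfl), List.finRange_zero, List.map_nil, List.prod_nil,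
      map_one, mul_one, PuncturedSurfaceGroup.genC, FreeGroup.lift_apply_of]
    exact mul_inv_cancel _
  let θ' : PuncturedSurfaceGroup h 1 →* FreeGroup ↥S := PresentedGroup.toGroup hrel
  have hθ'a : ∀ z : Fin h × Bool, θ' (PresentedGroup.of (Sum.inl z)) = Λ (FreeGroup.of z) := fun z =>
    PresentedGroup.toGroup.of hrel (x := Sum.inl z)
  have hθ'c : θ' (PuncturedSurfaceGroup.c 0) = (Λ sr)⁻¹ := PresentedGroup.toGroup.of hrel (x := Sum.inr 0)
  -- `θ'` is surjective
  have hsurj : Surjective θ' := by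
    rw [← MonoidHom.range_eq_top, eq_top_iff, ← Subgroup.map_top_of_surjective Λ.toMonoidHom Λ.surjective,
      ← FreeGroup.closure_range_of, MonoidHom.map_closure]
    refine (Subgroup.closure_le _).2 ?_
    rintro _ ⟨_, ⟨z, rfl⟩, rfl⟩
    exact ⟨PresentedGroup.of (Sum.inl z), hθ'a z⟩
  -- hence injective (hopfian), ranks `2h + 0 = |S|`
  obtain ⟨e⟩ := PuncturedSurfaceGroup.nonempty_mulEquiv_freeGroup h 0
  have hcard2 : Nat.card ((Fin h × Bool) ⊕ Fin 0) = Nat.card (↥S) := by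
    simp only [Nat.card_eq_fintype_card, Fintype.card_sum, Fintype.card_prod, Fintype.card_fin,
      Fintype.card_bool, Fintype.card_coe, ← hcardS]
    ring
  have hinj' : Injective θ' := FreeGroup.injective_of_surjective_of_mulEquiv e hcard2 θ' hsurj
  -- relabel back into `F(ι)`
  let V : FreeGroup ↥S →* FreeGroup ι := FreeGroup.map (Subtype.val : ↥S → ι)
  have hVi : Injective V := FreeGroup.map_injective Subtype.val_injective
  have hVw : V (FreeGroup.mk w') = FreeGroup.mk w := by
    rw [FreeGroup.map.mk, ← hw']
  refine ⟨V.comp θ', hVi.comp hinj', ?_, ⟨V c, ⟨?_, ?_⟩⟩⟩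
  · rw [MonoidHom.range_comp, MonoidHom.range_eq_top.2 hsurj, ← MonoidHom.range_eq_map,
      closure_eq_range_map]
  · rw [MonoidHom.range_comp, MonoidHom.range_eq_top.2 hsurj, ← MonoidHom.range_eq_map]
    exact ⟨c, rfl⟩
  · rw [MonoidHom.comp_apply, hθ'c, map_inv, hΛ, map_mul, map_mul, map_inv, hVw]
    group

end Literature.GroupTheory.CombinatorialGroupTheory
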